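import Mathlib.NumberTheory.ModularForms.CongruenceSubgroups
import HarnessLib

/-!
# Generators of `Γ₀(2^k)`: translations, `-1`, and the matrices with lower-left entry `2^k`

A small group-theoretic input for the modularity of the twisted Shintani theta kernels (route
towards Waldspurger's relation for Tunnell's theorem, files `Shintani*`): the transformation law of
a kernel under `γ ∈ Γ₀(256)` is computed by Poisson summation only for the matrices
`σ = (a b; 256 d)` whose lower-left entry is *exactly* `256` (then the modulus of the residue classes
is `256·D` with `D` odd, prime to `256`), and propagated to all of `Γ₀(256)` by

* `gamma0_le_closure_genSet` — **`Γ₀(2^k) ≤ ⟨T, -1, {σ ∈ SL₂(ℤ) : σ₁₀ = 2^k}⟩`** for every `k ≥ 1`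
  (hence equality, the generators lying in `Γ₀(2^k)`); `gamma0_256_le_closure` is the case `k = 8`.

Proof (descent on `|c|`): for `γ = (a b; c d) ∈ Γ₀(2^k)` with `c = 2^k c'`, `c' ≠ 0`, and any odd
`a'` there is `σ = (a' b'; 2^k d') ∈ SL₂(ℤ)` (`exists_sigma_of_odd`, Bézout), and
`(γσ)₁₀ = 2^k (c'a' + d)` (`mul_sigma_apply_10`). Writing `-d = q c' + ρ` with `0 ≤ ρ < |c'|`
(Euclidean division): if `ρ = 0` then `c' ∣ (c, d) = 1`, `c' = ±1`, and `a' = q = ∓d` is odd (`d`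
is odd as `c` is even) with `c'a' + d = 0`; otherwise both `a' = q` and `a' = q + sgn c'` give
`|c'a' + d| ∈ {ρ, |c'| - ρ} < |c'|`, and one of them is odd. Induction on `|c'|`; the case `c = 0`
is `γ = ±T^b` (`mem_closure_of_c_eq_zero`). (For a general level `N` two consecutive integers need
not contain one prime to `N`; for prime powers they do, which is all that is used here.)

No named facts; the only definition is the generating set `gamma0GenSet N`.

## References

* H. Rademacher, *Über die Erzeugenden von Kongruenzuntergruppen der Modulgruppe*, Abh. Math. Sem.
  Hamburg 7 (1929) 134–148 (generators of congruence subgroups).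
* G. Shimura, *Introduction to the arithmetic theory of automorphic functions* (1971), §1.6.
  [Shimura1971]
-/
open scoped MatrixGroups
open Matrix CongruenceSubgroup

namespace Literature.NumberTheory.EllipticCurves.ModularForms

/-- The generating set: `T`, `-1`, and all `σ = (a b; N d) ∈ SL₂(ℤ)` with lower-left entry exactly `N`. [folklore] -/
def gamma0GenSet (N : ℕ) : Set SL(2, ℤ) :=
  {ModularGroup.T} ∪ {-1} ∪ {σ | (σ 1 0 : ℤ) = N}

/-- `T_mem_gamma0GenSet` (auxiliary). [folklore] -/
theorem T_mem_gamma0GenSet (N : ℕ) : ModularGroup.T ∈ gamma0GenSet N := by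
  simp [gamma0GenSet]

/-- `neg_one_mem_gamma0GenSet` (auxiliary). [folklore] -/
theorem neg_one_mem_gamma0GenSet (N : ℕ) : (-1 : SL(2, ℤ)) ∈ gamma0GenSet N := by
  simp [gamma0GenSet]

/-- `mem_gamma0GenSet_of_eq` (auxiliary). [folklore] -/
theorem mem_gamma0GenSet_of_eq {N : ℕ} {σ : SL(2, ℤ)} (h : (σ 1 0 : ℤ) = N) : σ ∈ gamma0GenSet N := by
  simp [gamma0GenSet, h]

/-- Elements of `Γ₀(N)` with `c = 0` are `± T^b`. [folklore] -/
theorem mem_closure_of_c_eq_zero {N : ℕ} (γ : SL(2, ℤ)) (hc : (γ 1 0 : ℤ) = 0) :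
    γ ∈ Subgroup.closure (gamma0GenSet N) := by
  have hdet := γ.det_coe
  rw [Matrix.det_fin_two, hc, mul_zero, sub_zero] at hdet
  -- `a d = 1`: `a = d = ±1`
  have hT : ModularGroup.T ∈ Subgroup.closure (gamma0GenSet N) :=
    Subgroup.subset_closure (T_mem_gamma0GenSet N)
  have hneg : (-1 : SL(2, ℤ)) ∈ Subgroup.closure (gamma0GenSet N) :=
    Subgroup.subset_closure (neg_one_mem_gamma0GenSet N)
  rcases Int.eq_one_or_neg_one_of_mul_eq_one hdet with ha | ha
  · have hd : (γ 1 1 : ℤ) = 1 := by rw [ha, one_mul] at hdet; exact hdet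
    have : γ = ModularGroup.T ^ (γ 0 1 : ℤ) := by
      ext i j
      rw [ModularGroup.coe_T_zpow]
      fin_cases i <;> fin_cases j <;> simp [ha, hc, hd]
    rw [this]
    exact Subgroup.zpow_mem _ hT _
  · have hd : (γ 1 1 : ℤ) = -1 := by
      rw [ha] at hdet; linarith
    have : γ = -1 * ModularGroup.T ^ (-(γ 0 1 : ℤ)) := by
      ext i j
      rw [Matrix.SpecialLinearGroup.coe_mul, ModularGroup.coe_T_zpow]
      fin_cases i <;> fin_cases j <;> simp [ha, hc, hd]
    rw [this]
    exact Subgroup.mul_mem _ hneg (Subgroup.zpow_mem _ hT _)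

/-- For odd `a'` there is `σ = (a' b'; 2^k d') ∈ SL₂(ℤ)`. [folklore] -/
theorem exists_sigma_of_odd (k : ℕ) {a' : ℤ} (ha' : Odd a') :
    ∃ σ : SL(2, ℤ), (σ 0 0 : ℤ) = a' ∧ (σ 1 0 : ℤ) = (2 ^ k : ℕ) := by
  have hcop : IsCoprime a' ((2 : ℤ) ^ k) := by
    apply IsCoprime.pow_right
    rw [Int.isCoprime_iff_gcd_eq_one]
    have := Int.not_even_iff_odd.mpr ha'
    rw [even_iff_two_dvd] at this
    have h := Int.gcd_dvd_right a' 2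
    have h2 : (Int.gcd a' 2 : ℤ) ∣ 2 := h
    have hle : Int.gcd a' 2 ≤ 2 := Nat.le_of_dvd two_pos (by exact_mod_cast h2)
    interval_cases hg : Int.gcd a' 2
    · have := Int.gcd_eq_zero_iff.mp hg; omega
    · rfl
    · exfalso; apply this
      have := Int.gcd_dvd_left a' 2
      rw [hg] at this
      exact_mod_cast this
  obtain ⟨u, v, huv⟩ := hcop
  -- `u a' + v 2^k = 1`: take `d' = u`, `b' = -v`
  refine ⟨⟨!![a', -v; (2 ^ k : ℕ), u], ?_⟩, rfl, rfl⟩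
  rw [Matrix.det_fin_two_of]
  push_cast
  linear_combination huv

/-- One of two integers differing by `±1` is odd. [folklore] -/
theorem exists_odd_of_step (q s : ℤ) (hs : s = 1 ∨ s = -1) : Odd q ∨ Odd (q + s) := by
  rcases Int.even_or_odd q with hq | hq
  · right
    rcases hs with rfl | rfl
    · exact hq.add_one
    · have : q + -1 = q - 1 := by ring
      rw [this]; exact hq.sub_odd odd_one
  · exact Or.inl hq

/-- The reduction step: right multiplication by `σ = (a' *; 2^k *)` changes the lower-left entry
`c = 2^k c'` of `γ` into `2^k (c' a' + d)`. [folklore] -/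
theorem mul_sigma_apply_10 (γ σ : SL(2, ℤ)) :
    ((γ * σ) 1 0 : ℤ) = (γ 1 0 : ℤ) * σ 0 0 + (γ 1 1 : ℤ) * σ 1 0 := by
  rw [Matrix.SpecialLinearGroup.coe_mul, Matrix.mul_apply, Fin.sum_univ_two]

/-- **`Γ₀(2^k)` is generated by `T`, `-1` and its elements with lower-left entry `2^k`**:
reduce `|c|` by right multiplication with `σ = (a' b'; 2^k d')`, `a'` an odd integer next to
`-d/(c/2^k)` (Euclidean division). [folklore] -/
theorem gamma0_le_closure_genSet (k : ℕ) (hk : 1 ≤ k) :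
    Gamma0 (2 ^ k) ≤ Subgroup.closure (gamma0GenSet (2 ^ k)) := by
  -- strong induction on `|c| / 2^k`
  suffices H : ∀ n : ℕ, ∀ γ : SL(2, ℤ), γ ∈ Gamma0 (2 ^ k) → (γ 1 0 : ℤ).natAbs ≤ n * 2 ^ k →
      γ ∈ Subgroup.closure (gamma0GenSet (2 ^ k)) by
    intro γ hγ
    exact H ((γ 1 0 : ℤ).natAbs) γ hγ (Nat.le_mul_of_pos_right _ (by positivity))
  have h2k : (0 : ℤ) < (2 ^ k : ℕ) := by positivity
  intro n
  induction n with
  | zero =>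
    intro γ _ hle
    simp only [zero_mul, nonpos_iff_eq_zero, Int.natAbs_eq_zero] at hle
    exact mem_closure_of_c_eq_zero γ hle
  | succ n ih =>
    intro γ hγ hle
    set c : ℤ := γ 1 0 with hcdef
    set d : ℤ := γ 1 1 with hddef
    have hdiv : ((2 ^ k : ℕ) : ℤ) ∣ c := by
      have := (Gamma0_mem (N := 2 ^ k) (A := γ)).mp hγ
      exact (ZMod.intCast_zmod_eq_zero_iff_dvd c (2 ^ k)).mp this
    obtain ⟨c', hc'⟩ := hdiv
    by_cases hc0 : c' = 0
    · apply mem_closure_of_c_eq_zero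
      rw [← hcdef, hc', hc0, mul_zero]
    have hdet := γ.det_coe
    rw [Matrix.det_fin_two, ← hcdef, ← hddef] at hdet
    -- `d` is odd (`c` is even)
    have hdodd : Odd d := by
      by_contra hd
      rw [Int.not_odd_iff_even] at hd
      have h2c : (2 : ℤ) ∣ c := by
        rw [hc']; exact dvd_mul_of_dvd_left (by
          exact_mod_cast dvd_pow_self 2 (by omega : k ≠ 0)) _
      have : (2 : ℤ) ∣ (γ 0 0 : ℤ) * d - (γ 0 1 : ℤ) * c :=
        dvd_sub (dvd_mul_of_dvd_right (even_iff_two_dvd.mp hd) _) (dvd_mul_of_dvd_right h2c _)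
      rw [hdet] at this
      omega
    -- `|c'| ≤ n + 1`
    have hc'le : c'.natAbs ≤ n + 1 := by
      have : c.natAbs = 2 ^ k * c'.natAbs := by rw [hc', Int.natAbs_mul]; simp
      rw [this] at hle
      nlinarith [pow_pos (by norm_num : (0 : ℕ) < 2) k]
    -- how a `σ = (a' *; 2^k *)` acts, and when the product is again in `Γ₀(2^k)`
    have step : ∀ a' : ℤ, Odd a' → (c' * a' + d).natAbs ≤ n →
        γ ∈ Subgroup.closure (gamma0GenSet (2 ^ k)) := by
      intro a' ha' hlt
      obtain ⟨σ, hσ0, hσ1⟩ := exists_sigma_of_odd k ha'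
      have hσmem : σ ∈ Subgroup.closure (gamma0GenSet (2 ^ k)) :=
        Subgroup.subset_closure (mem_gamma0GenSet_of_eq hσ1)
      have h10 : ((γ * σ) 1 0 : ℤ) = (2 ^ k : ℕ) * (c' * a' + d) := by
        rw [mul_sigma_apply_10, ← hcdef, ← hddef, hc', hσ0, hσ1]; ring
      have hmem : γ * σ ∈ Gamma0 (2 ^ k) := by
        rw [Gamma0_mem, h10, Int.cast_mul, Int.cast_natCast, ZMod.natCast_self, zero_mul]
      have hprod : γ * σ ∈ Subgroup.closure (gamma0GenSet (2 ^ k)) := by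
        apply ih _ hmem
        rw [h10, Int.natAbs_mul]
        simp only [Int.natAbs_natCast]
        nlinarith [pow_pos (by norm_num : (0 : ℕ) < 2) k]
      have : γ = (γ * σ) * σ⁻¹ := by group
      rw [this]
      exact Subgroup.mul_mem _ hprod (Subgroup.inv_mem _ hσmem)
    -- Euclidean division `-d = q c' + ρ`, `0 ≤ ρ < |c'|`
    set q : ℤ := (-d) / c' with hq
    set ρ : ℤ := (-d) % c' with hρ
    have hqρ : ρ + q * c' = -d := Int.emod_add_ediv_mul (-d) c'
    have hρ0 : 0 ≤ ρ := Int.emod_nonneg _ hc0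
    have hρlt : ρ < |c'| := Int.emod_lt_abs _ hc0
    by_cases hρz : ρ = 0
    · -- `c' ∣ d`: then `c' = ±1`, and `a' = q` kills `c`
      have hcd : c' * q + d = 0 := by rw [hρz] at hqρ; linear_combination hqρ
      have hunit : c' ∣ 1 := by
        have h1 : c' ∣ d := ⟨-q, by linear_combination hcd⟩
        have h2 : c' ∣ c := ⟨(2 ^ k : ℕ), by rw [hc']; ring⟩
        rw [← hdet]
        exact dvd_sub (dvd_mul_of_dvd_right h1 _) (dvd_mul_of_dvd_right h2 _)
      have hq_odd : Odd q := by
        rcases Int.isUnit_iff.mp (isUnit_of_dvd_one hunit) with h1 | h1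
        · have : q = -d := by rw [h1] at hcd; linear_combination hcd
          rw [this]; exact hdodd.neg
        · have : q = d := by rw [h1] at hcd; linear_combination -hcd
          rw [this]; exact hdodd
      exact step q hq_odd (by rw [hcd]; simp)
    · -- `0 < ρ < |c'|`: `a' ∈ {q, q + sgn c'}` both reduce `|c|`; one of them is odd
      have hρpos : 0 < ρ := lt_of_le_of_ne hρ0 (Ne.symm hρz)
      set sg : ℤ := Int.sign c' with hsg
      have hsg1 : sg = 1 ∨ sg = -1 := by
        rcases lt_or_gt_of_ne hc0 with h | h
        · right; exact Int.sign_eq_neg_one_of_neg h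
        · left; exact Int.sign_eq_one_of_pos h
      have habs : c' * sg = |c'| := by rw [hsg, Int.mul_sign_self, Int.natCast_natAbs]
      have v0 : (c' * q + d).natAbs ≤ n := by
        have e : c' * q + d = -ρ := by linear_combination hqρ
        rw [e, Int.natAbs_neg]
        have : ρ.natAbs < c'.natAbs := by
          zify
          rw [abs_of_nonneg hρ0]
          exact hρlt
        omega
      have v1 : (c' * (q + sg) + d).natAbs ≤ n := by
        have e : c' * (q + sg) + d = |c'| - ρ := by linear_combination hqρ + habs
        rw [e]
        have h1 : 0 ≤ |c'| - ρ := by linarith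
        have h2 : (|c'| - ρ).natAbs < c'.natAbs := by
          zify
          rw [abs_of_nonneg h1]
          linarith
        omega
      rcases exists_odd_of_step q sg hsg1 with hodd | hodd
      · exact step q hodd v0
      · exact step (q + sg) hodd v1

/-- The `2^k = 256` case used for the Shintani kernels. [folklore] -/
theorem gamma0_256_le_closure : Gamma0 256 ≤ Subgroup.closure (gamma0GenSet 256) := by
  have := gamma0_le_closure_genSet 8 (by norm_num)
  norm_num at this
  exact this

end Literature.NumberTheory.EllipticCurves.ModularForms
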